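/-
Copyright: lit-balaban Phase-2 proof seat p34 (gen 18).  Statement-level skeleton of a published paper; no proof claims beyond what the
kernel checks below.
-/
import Literature.MathematicalPhysics.QuantumFieldTheory.BalabanImbrieJaffe1984to88.BIJ88NeumannPropagatorSmallFieldCubeDeriv
import Literature.MathematicalPhysics.QuantumFieldTheory.BalabanImbrieJaffe1984to88.BIJ88NeumannPropagatorSmallFieldRegionSup

/-!
# [Balaban1983RegularityDecay] (1.10) p. 573 / [BalabanImbrieJaffe1988] p. 263 / [BalabanImbrieJaffe1985] §7.3 p. 326 — **THE
# COVARIANT-DERIVATIVE MEMBER OF THE SUP-NORM DECAY FOR THE REGION NEUMANN PROPAGATORS `G_k(Ω,u)` ON A GENERAL `k`-BLOCK UNION AT SMALL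
# NON-FLAT FIELDS, `k`-UNIFORM, IN OPERATOR (`‖f‖_∞`) FORM, AT THE BONDS OF DEPTH `≥ L^k` IN `Ω`:
# `|(D_uG_k(Ω,u)f)(b)| ≤ c₁(L^kε)e^{−t₀ dist(b, supp f)/L^k}‖f‖_∞`** — p34 gen 17's cube theorem `decay110_smallField_cube_deriv` with the cube
# replaced by an arbitrary block union, now that the VALUE member for general block unions (gen 18's `decay110_smallField_region`) is in the tree

T. Bałaban, J. Imbrie, A. Jaffe, *Effective action and cluster properties of the abelian Higgs model*, Commun. Math. Phys. **114** (1988)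
257–315 [BalabanImbrieJaffe1988], Sect. 2 p. 263 [PDF 7], lines after (2.31): *"Bounds analogous to (2.30), (2.31) hold for covariant
derivatives and Hölder derivatives of G_{k,loc}(u) of order less than two"*; [I] = T. Bałaban, J. Imbrie, A. Jaffe, *Renormalization of the
Higgs model: minimizers, propagators and the stability of mean field theory*, Commun. Math. Phys. **97** (1985) 299–329
[BalabanImbrieJaffe1985], §7.3 p. 326 [PDF 28], (7.3.1)–(7.3.2), (2.7) p. 303; [6] = [7]_I = T. Bałaban, *Regularity and decay of lattice
Green's functions*, Commun. Math. Phys. **89** (1983) 571–597 [Balaban1983RegularityDecay], Theorem p. 573, (1.10).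

statement-level skeleton of published theorems with citation tags; proofs where landed; nothing here is a claim about the Yang–Mills mass gap

PDF held: `paper:balaban1988-cmp114-bij-abelian-higgs-effective-action` p. 263 [PDF 7]; `paper:balaban1985-cmp97-bij-higgs-minimizers`
p. 326 [PDF 28]; `paper:balaban1983-cmp89-regularity-decay` p. 573 [PDF 3].

CITATION HEADER (lean-in-tree rule).  Part of the lit-balaban TYPED SKELETON (HOME `run/shared/lean/pub/lit-balaban/`), PHASE-2 proof seat
p34 gen 18 (unit `lit-balaban-p34-g18`; TAKING line HOME/STATUS.md 2026-08-23T04:22:50Z, front (α′) of the owner's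
`HOME/lit-balaban-r18/C2S14-CLOSURE.md`; this file = the D_u companion named OPEN (b) in gen 17's HANDOFF block *"D_u OPERATOR member for
GENERAL block unions Ω — needs the VALUE member for regions in operator form"*, which gen 18's file 4 supplies).  WHAT IS REPRODUCED: a located
MEMBER of rows **C2.Claim@263** / **C2.Eq2.30** (owner r18) and **C1.Eq7.3.1-7.3.2** (owner r15) — the COVARIANT-DERIVATIVE member of [6]
(1.10) in `k`-uniform OPERATOR form for p31's REGION propagators on a GENERAL `k`-block union at non-flat small `u`, deep bonds.  No row is
restated and no head changes.
USED BY NAME: gen 17's `nOp_univ_mulVec_apply_eq_of_interior`, `nOp_gaugeAct_mulVec_apply`, `norm_covD_gBox_gaugeAct_mulVec`,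
`norm_toC_plaqHol_gaugeAct_sub_one` (`BIJ88NeumannPropagatorSmallFieldCubeDeriv`) and `smallField_blockGauge`
(`BIJ88NeumannPropagatorSmallPlaquetteRegion`); gen 18's `decay110_smallField_region` (`BIJ88NeumannPropagatorSmallFieldRegionSup`); p30's
`local_gradient_bound`, `flat_kernel_diffs`, `norm_covDiff_gaugeAct`, `two_mul_pow_le_sitesPerDir`, `gamma_nsq_le_one`, `centredGauge`,
`dist1_centredGauge_le`; p31's `gBox`/`nOp`, `IsBlockUnion`; r18's `starB`.  Kind: theorems only (no definition, no `Prop`-valued fact).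

THE PROOF: gen 17's §4 VERBATIM with the cube `□` replaced by `Ω` — that proof used the cube only through (i) the value member (here
`decay110_smallField_region`), (ii) `IsBlockUnion k □` (here a hypothesis), (iii) the depth `dep z = dist_∞(z, T∖□)` (defined for any finite
complement); see gen 17's docstring for the method (p30's interior gradient estimate at the maximal bond in the centre-rooted axial gauge,
the value bound for the local sup, the DEPTH-WEIGHTED maximum principle over the bonds, absorption `2C_Le·γr² ≤ 1/2`).  DIVERGENCE OF METHOD
from the print (which defers to an extension of [7]'s random-walk proofs), disclosed as in gen 17.

WHAT IS PROVED (0 `sorry`; standard axioms; theorems only).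
* §0–§1 private bookkeeping (copies of gen 17's §0/§3 helpers: `supDist_shift_le_succ`, …, `absorb_step`, `budget_step`, `shallow_step`).
* §2 **`decay110_smallField_region_deriv (d L) (hd1 : 1 ≤ d) (hd3 : d+1 ≤ 3) (hL : Odd L ∧ 1 < L) (ha : 0 < a)`**: `∃ t₀ c₁ > 0, ∀ P,
  P.d = d+1 → P.L = L → ∀ k, 1 ≤ k ≤ K → ∀ Ω, IsBlockUnion k Ω → ∀ U θ T δ, [plaquettes within θ, 2(d+1)³(L^{2k}θ)² ≤ 1; bondwise (T,δ)
  inside Ω] → ∀ x μ f F D, |f| ≤ F → (f ≠ 0 ⟹ D ≤ |x−·|_∞) → dist_∞(x, T∖Ω) ≥ L^k →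
  ‖(D_uG_k(Ω,u)f)(⟨x,μ⟩)‖ ≤ c₁(L^kε)e^{−t₀D/L^k}F`.
* §3 **`decay110_smallField_region_deriv_input`** (r01's (H1.10″)-deriv binder: `B5Ineq137Torus.T`, `(L^kε)·(c₁e^{−t₀(L^k)⁻¹D}F)`, deep rows
  as a ball condition), **`decay110_smallField_region_deriv_gaugeAct`** (every gauge copy `u^h`),
  **`decay110_smallPlaquette_region_deriv_uniform`** and **`_uniform_input`** (the same under (7.3.1)-TYPE fine-plaquette
  smallness only, threshold in `(d, L^k)`, no gauge condition, EVERY block union — via the blockwise centred gauge `smallField_blockGauge`).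

HONEST SCOPE.  (i) Operator (`‖f‖_∞`) form, `k`-uniform constants, but ONLY AT BONDS `⟨x, x+e_μ⟩` WITH `dist_∞(x, T∖Ω) ≥ L^k` — print's
*"dist(x,Ω^c) ≥ R₀"* with `R₀` one `L^{−k}`-lattice unit; bonds closer to `∂Ω` are not covered (for `Ω = T` the restriction is void).
(ii) GENERAL `k`-block unions (the cube case is gen 17's file).  (iii) `P.d = d + 1 ∈ {2, 3}`, `L` odd `> 1`, `1 ≤ k ≤ K`.  (iv) Hypotheses =
the union of the value member's (bondwise, feeding the local sup) and p30's (plaquettes, feeding the local gauges); §3 derives the former from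
the latter block by block at the displayed threshold `θ ≲ (d^{3/2}L^{2k})^{−1}`; THE PRINTED (7.3.1) is a UNIT-lattice plaquette smallness —
nothing beyond the displayed inequalities is asserted about the passage (p33's `BIJ85Claim73PropagatorDecay` lane).  (v) Constants as in gen 17
(`t₀ = min(t_v, 1)`, `c₁ = 2C_LK₁ + 32e·c_v/c + 1` from the REGION value member's `(t_v, c_v)`), depending on `(d, L, a)` only — uniform in
`k`, the region, the volume and the field.  (vi) No Hölder member, no closeness member.  (vii) `set_option maxHeartbeats 800000` on §2 (as in
gen 17).  Nothing here is summit progress.  Unit `lit-balaban-p34` (literature-prover-lit-balaban-p34-g18-0), HOME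
`run/shared/lean/pub/lit-balaban/`, 2026-08-23.
-/

open scoped BigOperators ComplexConjugate
open Finset Matrix

namespace Literature.MathematicalPhysics.QuantumFieldTheory.BalabanImbrieJaffe1984to88.BIJ88NeumannPropagatorSmallFieldRegionDeriv

open Literature.MathematicalPhysics.QuantumFieldTheory.Balaban1983to89
open LatticeFieldCalculus (supDist)
open B3TorusRadialSums (cdist cdist_le_supDist supDist_comm supDist_eq_sup_cdist supDist_eq_zero_iff cdist_neg cdist_le_val)
open BIJ85Ineq722Torus (supDist_triangle)
open BIJ88Sect3Statements (U1 toC cfg covD starB mem_starB norm_toC toC_one)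
open BIJ85BlockAveragesTorus BIJ85BlockAveragesTorusK
open BIJ88NeumannNoZeroModesTorus (IsBlockUnion)
open BIJ88NeumannPropagator227Torus (nOp gBox dN qMatK proj nOp_eq qMatK_apply qMatK_mulVec proj_mulVec)
open BIJ88NeumannPropagatorSmallFieldRegion (nOp_mulVec_gBox_mulVec gBox_mulVec_eq_zero_of_not_mem)
open BIJ88DeltaLoc234Torus (mulOp gBox_gaugeAct conjTranspose_mul_mulOp)
open BIJ85CovariantHiggsDictionary (gram_dN_mulVec_apply_region)
open BIJ85ScalarPropagatorSupDecayDeriv (local_gradient_bound cfg_gaugeAct_apply norm_covDiff_gaugeAct dist1_plaqHol_le_of_plaqC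
  two_mul_pow_le_sitesPerDir gamma_nsq_le_one)
open BIJ88NeumannPropagatorSmallFieldCubeDeriv (nOp_univ_mulVec_apply_eq_of_interior nOp_gaugeAct_mulVec_apply norm_covD_gBox_gaugeAct_mulVec
  norm_toC_plaqHol_gaugeAct_sub_one)
open BIJ88NeumannPropagatorSmallFieldRegionSup (decay110_smallField_region)

noncomputable section

variable {P : Params}

/-! ## §0 Torus bookkeeping (one lattice step in the sup-distance; private copies of gen 17's §0) -/

/-- kernel: the `μ`-coordinate of `z + e_μ` is `z_μ + 1`. [folklore] -/
private theorem shift_apply_self' (z : Balaban1983to89.Site P 0) (μ : Fin P.d) : z.shift μ μ = z μ + 1 := by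
  simp [Balaban1983to89.Site.shift]

/-- kernel: the other coordinates of `z + e_μ` are those of `z`. [folklore] -/
private theorem shift_apply_ne' (z : Balaban1983to89.Site P 0) {μ ν : Fin P.d} (h : ν ≠ μ) : z.shift μ ν = z ν := by
  simp [Balaban1983to89.Site.shift, Function.update_of_ne h]

/-- kernel: one lattice step moves the sup distance by at most one. [folklore] -/
private theorem supDist_shift_le_one' (x : Balaban1983to89.Site P 0) (μ : Fin P.d) : supDist x (x.shift μ) ≤ 1 := by
  rw [supDist_eq_sup_cdist]
  refine Finset.sup_le fun ν _ => ?_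
  by_cases hν : ν = μ
  · subst hν
    have h : x ν - x.shift ν ν = -1 := by rw [shift_apply_self']; ring
    rw [h, cdist_neg]
    exact (cdist_le_val _).trans (by rw [ZMod.val_one_eq_one_mod]; exact Nat.mod_le 1 _)
  · rw [shift_apply_ne' x hν, sub_self]
    exact (cdist_le_val _).trans (by simp)

/-- kernel: `|y₀ − (z+e_μ)|_∞ ≤ |y₀ − z|_∞ + 1`. [folklore] -/
private theorem supDist_shift_le_succ (y₀ z : Balaban1983to89.Site P 0) (μ : Fin P.d) : supDist y₀ (z.shift μ) ≤ supDist y₀ z + 1 :=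
  (supDist_triangle y₀ z (z.shift μ)).trans (Nat.add_le_add_left (supDist_shift_le_one' z μ) _)

/-- kernel: `(z − e_μ) + e_μ = z`. [folklore] -/
private theorem unshift_shift' (z : Balaban1983to89.Site P 0) (μ : Fin P.d) : (z.unshift μ).shift μ = z :=
  (LatticeFieldCalculus.shiftEquiv μ).right_inv z

/-- kernel: `|y₀ − (z−e_μ)|_∞ ≤ |y₀ − z|_∞ + 1`. [folklore] -/
private theorem supDist_unshift_le_succ (y₀ z : Balaban1983to89.Site P 0) (μ : Fin P.d) :
    supDist y₀ (z.unshift μ) ≤ supDist y₀ z + 1 := by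
  have h := supDist_triangle y₀ z (z.unshift μ)
  have h1 : supDist z (z.unshift μ) ≤ 1 := by
    have h2 := supDist_shift_le_one' (z.unshift μ) μ
    rwa [unshift_shift', supDist_comm] at h2
  exact h.trans (Nat.add_le_add_left h1 _)

/-! ## §1 Scalar bookkeeping (private copies of gen 17's §3: all real arithmetic of the absorption step) -/

/-- kernel: `min(A, B)/2 ≤ min(A, B/2)` for `A ≥ 0`. [folklore] -/
private theorem min_div_two_le {A B : ℝ} (hA : 0 ≤ A) : min A B / 2 ≤ min A (B / 2) := by
  rcases le_total A B with h | h
  · rw [min_eq_left h]; exact le_min (by linarith) (by linarith)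
  · rw [min_eq_right h]; exact le_min (by linarith) (by linarith)

/-- kernel: `min(A, B)/4 ≤ min(A, B/2 − 1)` for `A ≥ 0`, `B ≥ 4`. [folklore] -/
private theorem min_div_four_le {A B : ℝ} (hA : 0 ≤ A) (hB : 4 ≤ B) : min A B / 4 ≤ min A (B / 2 - 1) := by
  rcases le_total A B with h | h
  · rw [min_eq_left h]; exact le_min (by linarith) (by linarith)
  · rw [min_eq_right h]; exact le_min (by linarith) (by linarith)

/-- kernel: the weight `min(R, max(0, ρ))/R` lies in `[0, 1]` (`R > 0`). [folklore] -/
private theorem weight_mem {R ρ : ℝ} (hR : 0 < R) : 0 ≤ min R (max 0 ρ) / R ∧ min R (max 0 ρ) / R ≤ 1 :=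
  ⟨div_nonneg (le_min hR.le (le_max_left _ _)) hR.le, by rw [div_le_one hR]; exact min_le_left _ _⟩

/-- kernel: the ABSORPTION STEP — the local estimate `M·E/W ≤ C(F_loc ε²r + γr²·M_loc + (γr + 1/r + αε²(r+n))S)` with `F_loc = F·E·e`,
`M_loc = 2M·E·e/W`, `S = S₀·E` and the contraction `2C·e·γr² ≤ 1/2` give `M ≤ 2·C·W·(F·e·ε²r + (γr + 1/r + αε²(r+n))S₀)`. [folklore] -/
private theorem absorb_step {M E W e C F ε r γ S₀ α n : ℝ} (hE : 0 < E) (hW : 0 < W) (hM : 0 ≤ M) (hr : 0 < r)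
    (hκ : C * (γ * r ^ 2) * (2 * e) ≤ 1 / 2)
    (h : M * E / W ≤ C * ((F * E * e) * ε ^ 2 * r + γ * r ^ 2 * (2 * M * E * e / W) + γ * r * (S₀ * E) + (S₀ * E) / r +
      α * ε ^ 2 * (r + n) * (S₀ * E))) :
    M ≤ 2 * (C * W * (F * e * ε ^ 2 * r + (γ * r + 1 / r + α * ε ^ 2 * (r + n)) * S₀)) := by
  set A : ℝ := C * W * (F * e * ε ^ 2 * r + (γ * r + 1 / r + α * ε ^ 2 * (r + n)) * S₀) with hA
  have h2 : M = (M * E / W) * (W / E) := by field_simp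
  have h3 : C * ((F * E * e) * ε ^ 2 * r + γ * r ^ 2 * (2 * M * E * e / W) + γ * r * (S₀ * E) + (S₀ * E) / r +
      α * ε ^ 2 * (r + n) * (S₀ * E)) * (W / E) = A + (C * (γ * r ^ 2) * (2 * e)) * M := by
    rw [hA]; field_simp; ring
  have h4 : M * E / W * (W / E) ≤ C * ((F * E * e) * ε ^ 2 * r + γ * r ^ 2 * (2 * M * E * e / W) + γ * r * (S₀ * E) + (S₀ * E) / r +
      α * ε ^ 2 * (r + n) * (S₀ * E)) * (W / E) := mul_le_mul_of_nonneg_right h (by positivity)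
  rw [← h2, h3] at h4
  have h5 : (C * (γ * r ^ 2) * (2 * e)) * M ≤ (1 / 2) * M := mul_le_mul_of_nonneg_right hκ hM
  linarith

/-- kernel: the BUDGET of the absorbed terms — with `W ≤ 1`, `r ≤ cb·n ≤ n/8`, `γn² ≤ 1`, `W/r ≤ 8/(cb·n)`, `α·sp² ≤ a`, `sp = nε`:
`W·(F·e·ε²r + (γr + 1/r + αε²(r+n))·c_v·sp²·F·e³) ≤ K₁·nε²F`, `K₁ = e·cb + c_v e³(cb + 8/cb + 2a)`. [folklore] -/
private theorem budget_step {W F e ε r γ cb n c_v sp α a : ℝ} (hW1 : W ≤ 1) (hF : 0 ≤ F) (he : 0 ≤ e)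
    (hr : 0 < r) (hγ : 0 ≤ γ) (hcb : 0 < cb) (hn : 0 < n) (hcv : 0 ≤ c_v) (hα : 0 ≤ α) (ha : 0 ≤ a)
    (hrc : r ≤ cb * n) (hrn : r ≤ n / 8) (hγn : γ * n ^ 2 ≤ 1) (hWr : W / r ≤ 8 / (cb * n)) (hαa : α * sp ^ 2 ≤ a)
    (hsp : sp = n * ε) :
    W * (F * e * ε ^ 2 * r + (γ * r + 1 / r + α * ε ^ 2 * (r + n)) * (c_v * sp ^ 2 * F * e ^ 3)) ≤
      (e * cb + c_v * e ^ 3 * (cb + 8 / cb + 2 * a)) * (n * ε ^ 2 * F) := by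
  have hsp2 : sp ^ 2 = n ^ 2 * ε ^ 2 := by rw [hsp]; ring
  have q1 : W * (F * e * ε ^ 2 * r) ≤ (e * cb) * (n * ε ^ 2 * F) := by
    calc W * (F * e * ε ^ 2 * r) ≤ 1 * (F * e * ε ^ 2 * (cb * n)) := by gcongr
      _ = (e * cb) * (n * ε ^ 2 * F) := by ring
  have q2 : W * (γ * r * (c_v * sp ^ 2 * F * e ^ 3)) ≤ (c_v * e ^ 3 * cb) * (n * ε ^ 2 * F) := by
    have h1 : γ * r * n ^ 2 ≤ cb * n := by
      calc γ * r * n ^ 2 ≤ γ * (cb * n) * n ^ 2 := by gcongr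
        _ = cb * n * (γ * n ^ 2) := by ring
        _ ≤ cb * n * 1 := mul_le_mul_of_nonneg_left hγn (by positivity)
        _ = cb * n := mul_one _
    calc W * (γ * r * (c_v * sp ^ 2 * F * e ^ 3)) ≤ 1 * (γ * r * (c_v * sp ^ 2 * F * e ^ 3)) := by gcongr
      _ = (γ * r * n ^ 2) * (c_v * ε ^ 2 * F * e ^ 3) := by rw [hsp2]; ring
      _ ≤ (cb * n) * (c_v * ε ^ 2 * F * e ^ 3) := mul_le_mul_of_nonneg_right h1 (by positivity)
      _ = (c_v * e ^ 3 * cb) * (n * ε ^ 2 * F) := by ring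
  have q3 : W * (1 / r * (c_v * sp ^ 2 * F * e ^ 3)) ≤ (c_v * e ^ 3 * (8 / cb)) * (n * ε ^ 2 * F) := by
    have h3 : W / r * n ^ 2 ≤ (8 / cb) * n := by
      calc W / r * n ^ 2 ≤ (8 / (cb * n)) * n ^ 2 := mul_le_mul_of_nonneg_right hWr (by positivity)
        _ = (8 / cb) * n := by field_simp
    calc W * (1 / r * (c_v * sp ^ 2 * F * e ^ 3)) = (W / r * n ^ 2) * (c_v * ε ^ 2 * F * e ^ 3) := by rw [hsp2]; ring
      _ ≤ ((8 / cb) * n) * (c_v * ε ^ 2 * F * e ^ 3) := mul_le_mul_of_nonneg_right h3 (by positivity)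
      _ = (c_v * e ^ 3 * (8 / cb)) * (n * ε ^ 2 * F) := by ring
  have q4 : W * (α * ε ^ 2 * (r + n) * (c_v * sp ^ 2 * F * e ^ 3)) ≤ (c_v * e ^ 3 * (2 * a)) * (n * ε ^ 2 * F) := by
    have h1 : r + n ≤ 2 * n := by linarith
    calc W * (α * ε ^ 2 * (r + n) * (c_v * sp ^ 2 * F * e ^ 3)) ≤ 1 * (α * ε ^ 2 * (r + n) * (c_v * sp ^ 2 * F * e ^ 3)) := by gcongr
      _ = (α * sp ^ 2) * (r + n) * (c_v * ε ^ 2 * F * e ^ 3) := by ring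
      _ ≤ a * (2 * n) * (c_v * ε ^ 2 * F * e ^ 3) := by gcongr
      _ = (c_v * e ^ 3 * (2 * a)) * (n * ε ^ 2 * F) := by ring
  have hexp : W * (F * e * ε ^ 2 * r + (γ * r + 1 / r + α * ε ^ 2 * (r + n)) * (c_v * sp ^ 2 * F * e ^ 3))
      = W * (F * e * ε ^ 2 * r) + W * (γ * r * (c_v * sp ^ 2 * F * e ^ 3)) + W * (1 / r * (c_v * sp ^ 2 * F * e ^ 3)) +
        W * (α * ε ^ 2 * (r + n) * (c_v * sp ^ 2 * F * e ^ 3)) := by ring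
  have hK : (e * cb + c_v * e ^ 3 * (cb + 8 / cb + 2 * a)) * (n * ε ^ 2 * F) = (e * cb) * (n * ε ^ 2 * F) +
      (c_v * e ^ 3 * cb) * (n * ε ^ 2 * F) + (c_v * e ^ 3 * (8 / cb)) * (n * ε ^ 2 * F) + (c_v * e ^ 3 * (2 * a)) * (n * ε ^ 2 * F) := by
    ring
  rw [hexp, hK]; linarith [q1, q2, q3, q4]

/-- kernel: the SHALLOW-BOND budget — `(8/rm)·(2e·c_v·sp²·F) ≤ (32e·c_v/cb)·nε²F` when `rm ≥ cb·n/2`, `sp = nε`. [folklore] -/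
private theorem shallow_step {rm cb n e c_v sp ε F : ℝ} (hrm : 0 < rm) (hcb : 0 < cb) (hn : 0 < n) (he : 0 ≤ e) (hcv : 0 ≤ c_v)
    (hF : 0 ≤ F) (hrm2 : cb * n / 2 ≤ rm) (hsp : sp = n * ε) :
    (8 / rm) * (2 * e * c_v * sp ^ 2 * F) ≤ (32 * e * c_v / cb) * (n * ε ^ 2 * F) := by
  have hsp2 : sp ^ 2 = n ^ 2 * ε ^ 2 := by rw [hsp]; ring
  have h4 : 8 / rm * n ≤ 16 / cb := by
    rw [div_mul_eq_mul_div, div_le_div_iff₀ hrm hcb]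
    nlinarith [hrm2, hn.le, hcb.le]
  have h5 : 0 ≤ 2 * e * c_v * (n * ε ^ 2 * F) := by positivity
  calc 8 / rm * (2 * e * c_v * sp ^ 2 * F) = (8 / rm * n) * (2 * e * c_v * (n * ε ^ 2 * F)) := by rw [hsp2]; ring
    _ ≤ (16 / cb) * (2 * e * c_v * (n * ε ^ 2 * F)) := mul_le_mul_of_nonneg_right h4 h5
    _ = (32 * e * c_v / cb) * (n * ε ^ 2 * F) := by ring


/-! ## §2 [6] (1.10), COVARIANT-DERIVATIVE member, for the REGION propagators on a general `k`-block union, `k`-uniform, deep bonds -/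

section Main

set_option maxHeartbeats 800000 in
/-- **THE SUP-NORM DECAY OF THE COVARIANT DERIVATIVE OF THE REGION NEUMANN PROPAGATOR `G_k(Ω,u)` ON A GENERAL `k`-BLOCK UNION AT SMALL
NON-FLAT FIELDS, `k`-UNIFORM, AT THE BONDS OF DEPTH `≥ L^k` IN `Ω`** — the COVARIANT-DERIVATIVE member of [Balaban1983RegularityDecay] (1.10)
*"|(D^η_{A,μ}G_k(Ω, A)f)(x)|, |(G_k(Ω, A)f)(x)| ≤ c₀exp(−δ₀ dist(x, supp f))‖f‖_∞ (1.10) for x ∈ Ω, dist(x,Ω^c) ≥ R₀"* (here `R₀ = L^k` fine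
steps) for [BalabanImbrieJaffe1988] p. 263 *"Bounds analogous to (2.30), (2.31) hold for covariant derivatives … of G_{k,loc}(u)"* /
[BalabanImbrieJaffe1985] p. 326 *"The propagators arising from Δ_k(u_k), under the restriction (7.3.1) on the gauge field, also satisfy the
regularity and decay estimates of [7]"*, for p31's REGION propagator `G_k(Ω,u) = gBox (α_kL^{kd}) ε⁻¹ u k Ω` on an ARBITRARY union `Ω` of
`k`-blocks (`IsBlockUnion k Ω`), under the hypotheses of the VALUE member `BIJ88NeumannPropagatorSmallFieldRegionSup.decay110_smallField_region`
(bondwise `(T, δ)`-smallness inside `Ω`) and of p30's whole-torus derivative member (plaquettes within `θ` of `1`, `2d³(L^{2k}θ)² ≤ 1`): for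
`d + 1 ∈ {2, 3}`, `L` odd `> 1`, `a > 0` there are `t₀, c₁ > 0` (depending on `d, L, a` only) such that for every volume, every `1 ≤ k ≤ K`,
every `k`-block union `Ω`, every such field, every bond `⟨x, x + e_μ⟩` with `dist_∞(x, T∖Ω) ≥ L^k` and every `f` with `|f| ≤ F` vanishing at
sup-distance `< D` from `x`:  `|(D_uG_k(Ω,u)f)(⟨x, x+e_μ⟩)| ≤ c₁(L^kε)e^{−t₀D/L^k}F`.  PROOF = p34 gen 17's `decay110_smallField_cube_deriv`
VERBATIM with the cube replaced by `Ω` (that proof used the cube only through the value member, `IsBlockUnion`, and the depth to the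
complement): p30's interior gradient estimate `local_gradient_bound` at the maximal bond in the centre-rooted axial gauge, the region value
bound for the local sup, and the DEPTH-WEIGHTED maximum principle over the bonds of `Ω`.
[cite: BalabanImbrieJaffe1985, (7.3.1) p.326; Balaban1983RegularityDecay, (1.10) p.573] -/
theorem decay110_smallField_region_deriv (d L : ℕ) (hd1 : 1 ≤ d) (hd3 : d + 1 ≤ 3) (hL : Odd L ∧ 1 < L) {a : ℝ} (ha : 0 < a) :
    ∃ t₀ c₁ : ℝ, 0 < t₀ ∧ 0 < c₁ ∧ ∀ (P : Params), P.d = d + 1 → P.L = L →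
      ∀ k : ℕ, 1 ≤ k → k ≤ P.K → ∀ Ω : Finset (Balaban1983to89.Site P 0), IsBlockUnion k Ω →
        ∀ (U : GaugeField P 0 U1) (θ T δ : ℝ), 0 ≤ θ →
          (∀ p : Balaban1983to89.Plaq P 0, ‖toC (GaugeField.plaqHol U p) - 1‖ ≤ θ) →
          2 * (P.d : ℝ) ^ 3 * (((P.L : ℝ) ^ k) ^ 2 * θ) ^ 2 ≤ 1 →
          (∀ b ∈ starB Ω, blkIter k b.src = blkIter k b.tgt → ‖toC (U b) - 1‖ ≤ T) →
          (∀ y ∈ Ω, ‖holCK U k y - 1‖ ≤ δ) →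
          2 * (((P.L : ℝ) ^ k - 1) * (P.L : ℝ) ^ k) * P.d * T ^ 2 + 2 * δ ^ 2 ≤ 1 / 2 →
          ∀ (x : Balaban1983to89.Site P 0) (μ : Fin P.d) (f : Balaban1983to89.Site P 0 → ℂ) (F D : ℝ),
            (∀ z, ‖f z‖ ≤ F) → (∀ z, f z ≠ 0 → D ≤ (supDist x z : ℝ)) →
            (∀ w, w ∉ Ω → P.L ^ k ≤ supDist x w) →
            ‖covD P.eps⁻¹ (cfg U) (gBox (B1RG242Torus.α P a k * (P.L : ℝ) ^ (k * P.d)) P.eps⁻¹ U k Ω *ᵥ f) ⟨x, μ⟩‖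
              ≤ c₁ * P.spacing k * Real.exp (-(t₀ * D / (P.L : ℝ) ^ k)) * F := by
  classical
  obtain ⟨t₁, c_v, ht₁, hc_v, hval⟩ := decay110_smallField_region d (L - 1) hd3 (by omega) ha
  obtain ⟨C_K, hCK, hker⟩ := BIJ85FlatPropagatorKernelDiffs.flat_kernel_diffs (d + 1) L (by omega) hL ha (le_refl (0 : ℝ))
  obtain ⟨C_L, hCL, hloc⟩ := local_gradient_bound (d + 1) (by omega) C_K hCK.le
  -- the rate, the ball fraction and the constant
  set t : ℝ := min t₁ 1 with htdef
  have ht : 0 < t := lt_min ht₁ one_pos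
  have ht1 : t ≤ 1 := min_le_right _ _
  have htt₁ : t ≤ t₁ := min_le_left _ _
  set e : ℝ := Real.exp 1 with hedef
  have he1 : 1 ≤ e := by rw [hedef]; exact Real.one_le_exp (by norm_num)
  have he0 : 0 < e := Real.exp_pos 1
  set cb : ℝ := min (1 / 8) (1 / (4 * (C_L * e + 1))) with hcbdef
  have hc0 : 0 < cb := lt_min (by norm_num) (by positivity)
  have hc8 : cb ≤ 1 / 8 := min_le_left _ _
  have hc1 : cb ≤ 1 := hc8.trans (by norm_num)
  have hcC : C_L * e * cb ≤ 1 / 4 := by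
    have h1 : cb ≤ 1 / (4 * (C_L * e + 1)) := min_le_right _ _
    have h2 : 0 ≤ C_L * e := by positivity
    calc C_L * e * cb ≤ C_L * e * (1 / (4 * (C_L * e + 1))) := mul_le_mul_of_nonneg_left h1 h2
      _ ≤ 1 / 4 := by rw [mul_one_div, div_le_iff₀ (by positivity)]; linarith
  set K₁ : ℝ := e * cb + c_v * e ^ 3 * (cb + 8 / cb + 2 * a) with hK₁
  have hK₁0 : 0 ≤ K₁ := by positivity
  refine ⟨t, 2 * C_L * K₁ + 32 * e * c_v / cb + 1, ht, by positivity, ?_⟩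
  intro P hPd hPL k hk1 hkK Q hΩ U θ T δ hθ0 hplaq hsmall hInt hTree hsmallT x μ f F D hF hsupp hdeep
  have hk : k ≤ P.m + P.K := hkK.trans (Nat.le_add_left _ _)
  have hPL' : P.L = L - 1 + 1 := by omega
  have hvalP := hval P hPd hPL' k hk1 hk Q hΩ U T δ hInt hTree hsmallT
  have hkerP := hker P hPd hPL k hk1 hkK
  -- basic quantities
  have hd1' : 1 ≤ P.d := by omega
  have hk0 : 0 + k ≤ P.m + P.K := by omega
  have hLpos : (0 : ℝ) < P.L := P.cast_L_pos
  have hL1 : (1 : ℝ) < P.L := B1RG242Torus.one_lt_cast_L P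
  have hε : 0 < P.eps := P.eps_pos
  set n : ℝ := (P.L : ℝ) ^ k with hndef
  have hn : 0 < n := pow_pos hLpos k
  have hn1 : 1 ≤ n := one_le_pow₀ hL1.le
  have hncast : ((P.L ^ k : ℕ) : ℝ) = n := by rw [hndef]; push_cast; rfl
  have hn3 : 3 ≤ n := by
    have h3 : 3 ≤ P.L := by
      obtain ⟨hodd, hlt⟩ := hL
      rw [hPL]
      rcases hodd with ⟨m, hm⟩
      omega
    have h3' : (3 : ℝ) ≤ P.L := by exact_mod_cast h3
    calc (3 : ℝ) = 3 ^ 1 := by norm_num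
      _ ≤ (P.L : ℝ) ^ 1 := by gcongr
      _ ≤ (P.L : ℝ) ^ k := pow_le_pow_right₀ hL1.le hk1
  have hsp : P.spacing k = n * P.eps := rfl
  have hsp0 : 0 < P.spacing k := P.spacing_pos k
  have hα : 0 < B1RG242Torus.α P a k := mul_pos (B1.aSeq_pos ha hL1 hk1) (inv_pos.2 (pow_pos hsp0 2))
  have hαa : B1RG242Torus.α P a k * P.spacing k ^ 2 ≤ a := by
    show B1.aSeq a P.L k * (P.spacing k ^ 2)⁻¹ * P.spacing k ^ 2 ≤ a
    rw [inv_mul_cancel_right₀ (pow_ne_zero 2 hsp0.ne')]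
    exact B1.aSeq_le ha hL1 k hk1
  set a' : ℝ := B1RG242Torus.α P a k * (P.L : ℝ) ^ (k * P.d) with ha'def
  have ha' : 0 < a' := mul_pos hα (pow_pos hLpos _)
  have hc' : P.eps⁻¹ ≠ 0 := inv_ne_zero hε.ne'
  have hplaq' : ∀ p : Balaban1983to89.Plaq P 0, dist1 (GaugeField.plaqHol U p) ≤ θ := fun p => by
    rw [BIJ88Smooth43Axial.dist1_eq_norm_toC_sub_one]; exact hplaq p
  have hF0 : 0 ≤ F := (norm_nonneg _).trans (hF x)
  set φ := gBox a' P.eps⁻¹ U k Q *ᵥ f with hφ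
  have hexpD : ∀ {D₁ D₂ : ℝ}, D₂ ≤ D₁ → Real.exp (-(t * D₁ / n)) ≤ Real.exp (-(t * D₂ / n)) := fun h =>
    Real.exp_le_exp.2 (by rw [neg_le_neg_iff]; exact div_le_div_of_nonneg_right (mul_le_mul_of_nonneg_left h ht.le) hn.le)
  have hexp_t₁ : ∀ {D' : ℝ}, 0 ≤ D' → Real.exp (-(t₁ * D' / n)) ≤ Real.exp (-(t * D' / n)) := fun hD' =>
    Real.exp_le_exp.2 (by rw [neg_le_neg_iff]; exact div_le_div_of_nonneg_right (mul_le_mul_of_nonneg_right htt₁ hD') hn.le)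
  -- the target, spelled out
  have hgoal : ‖covD P.eps⁻¹ (cfg U) φ ⟨x, μ⟩‖ = P.eps⁻¹ * ‖cfg U ⟨x, μ⟩ * φ (x.shift μ) - φ x‖ := by
    show ‖((P.eps⁻¹ : ℝ) : ℂ) * (cfg U ⟨x, μ⟩ * φ (x.shift μ) - φ x)‖ = _
    rw [norm_mul, Complex.norm_real, Real.norm_of_nonneg (inv_nonneg.2 hε.le)]
  rw [hgoal]
  -- two values of `φ` bound a covariant difference: `‖u_bφ(b₊) − φ(b₋)‖ ≤ 2e·c_v·(L^kε)²e^{−tD_y/n}F` at any bond `⟨y, y+e_ν⟩` when `f`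
  -- vanishes within `D_y` of `y`
  have htwo : ∀ (y : Balaban1983to89.Site P 0) (ν : Fin P.d) (Dy : ℝ), (∀ z, f z ≠ 0 → Dy ≤ (supDist y z : ℝ)) →
      ‖cfg U ⟨y, ν⟩ * φ (y.shift ν) - φ y‖ ≤ 2 * e * c_v * P.spacing k ^ 2 * Real.exp (-(t * Dy / n)) * F := by
    intro y ν Dy hsy
    have hφy : ‖φ y‖ ≤ c_v * P.spacing k ^ 2 * Real.exp (-(t * Dy / n)) * F := by
      have h1 := hvalP y f F (max Dy 0) hF (fun z hz => max_le (hsy z hz) (Nat.cast_nonneg _))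
      refine h1.trans ?_
      have h2 : Real.exp (-(t₁ * max Dy 0 / n)) ≤ Real.exp (-(t * Dy / n)) := (hexp_t₁ (le_max_right _ _)).trans (hexpD (le_max_left _ _))
      gcongr
    have hφy' : ‖φ (y.shift ν)‖ ≤ c_v * P.spacing k ^ 2 * (e * Real.exp (-(t * Dy / n))) * F := by
      have h1 := hvalP (y.shift ν) f F (max (Dy - 1) 0) hF (fun z hz => ?_)
      · refine h1.trans ?_
        have h2 : Real.exp (-(t₁ * max (Dy - 1) 0 / n)) ≤ e * Real.exp (-(t * Dy / n)) := by
          refine ((hexp_t₁ (le_max_right _ _)).trans (hexpD (le_max_left _ _))).trans ?_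
          rw [hedef, ← Real.exp_add]
          refine Real.exp_le_exp.2 ?_
          rw [show -(t * (Dy - 1) / n) = -(t * Dy / n) + t / n by ring]
          have : t / n ≤ 1 := by rw [div_le_one hn]; exact ht1.trans hn1
          linarith only [this]
        gcongr
      · have h3 := hsy z hz
        have h4 : supDist y z ≤ supDist y (y.shift ν) + supDist (y.shift ν) z := supDist_triangle y (y.shift ν) z
        have h5 := supDist_shift_le_one' y ν
        have h6 : (supDist y z : ℝ) ≤ 1 + supDist (y.shift ν) z := by
          have : ((supDist y z : ℕ) : ℝ) ≤ ((supDist y (y.shift ν) + supDist (y.shift ν) z : ℕ) : ℝ) := by exact_mod_cast h4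
          have h5' : ((supDist y (y.shift ν) : ℕ) : ℝ) ≤ 1 := by exact_mod_cast h5
          push_cast at this; linarith only [this, h5']
        exact max_le (by linarith only [h3, h6]) (Nat.cast_nonneg _)
    refine (norm_sub_le _ _).trans ?_
    rw [norm_mul, show ‖cfg U ⟨y, ν⟩‖ = 1 from norm_toC _, one_mul]
    have hE : 0 ≤ Real.exp (-(t * Dy / n)) := (Real.exp_pos _).le
    have e1x : c_v * P.spacing k ^ 2 * Real.exp (-(t * Dy / n)) * F ≤ c_v * P.spacing k ^ 2 * (e * Real.exp (-(t * Dy / n))) * F := by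
      have : Real.exp (-(t * Dy / n)) ≤ e * Real.exp (-(t * Dy / n)) := le_mul_of_one_le_left hE he1
      gcongr
    linarith only [hφy, hφy', e1x]
  -- the radius of record of the interior estimate
  set rm : ℕ := ⌊cb * n⌋₊ with hrmdef
  have hrmc : (rm : ℝ) ≤ cb * n := Nat.floor_le (by positivity)
  by_cases hrm4 : rm < 4
  · ----------------------------------------------------------------------------------------------------------------
    -- SMALL CASE `cb·L^k < 4`: the trivial bound by two values of `φ`
    have hn4 : n < 4 / cb := by
      have h1 : cb * n < rm + 1 := Nat.lt_floor_add_one _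
      have h2 : (rm : ℝ) + 1 ≤ 4 := by exact_mod_cast hrm4
      rw [lt_div_iff₀ hc0]; linarith only [h1, h2]
    have hδ := htwo x μ D hsupp
    have hcoef : 2 * e * c_v * n ≤ 32 * e * c_v / cb := by
      rw [show 32 * e * c_v / cb = 2 * e * c_v * (16 / cb) by ring]
      refine mul_le_mul_of_nonneg_left ?_ (by positivity)
      have : 4 / cb ≤ 16 / cb := div_le_div_of_nonneg_right (by norm_num) hc0.le
      linarith only [this, hn4]
    calc P.eps⁻¹ * ‖cfg U ⟨x, μ⟩ * φ (x.shift μ) - φ x‖ ≤ P.eps⁻¹ * (2 * e * c_v * P.spacing k ^ 2 * Real.exp (-(t * D / n)) * F) :=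
          mul_le_mul_of_nonneg_left hδ (inv_nonneg.2 hε.le)
      _ = (2 * e * c_v * n) * P.spacing k * Real.exp (-(t * D / n)) * F := by rw [hsp]; field_simp
      _ ≤ (32 * e * c_v / cb) * P.spacing k * Real.exp (-(t * D / n)) * F := by gcongr
      _ ≤ _ := mul_le_mul_of_nonneg_right (mul_le_mul_of_nonneg_right (mul_le_mul_of_nonneg_right
          (by linarith only [show (0 : ℝ) ≤ 2 * C_L * K₁ by positivity]) hsp0.le) (Real.exp_pos _).le) hF0
  ----------------------------------------------------------------------------------------------------------------
  -- MAIN CASE `rm = ⌊cb·L^k⌋ ≥ 4`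
  push Not at hrm4
  have hrm0 : (0 : ℝ) < rm := by exact_mod_cast (show 0 < rm by omega)
  have hcn4 : 4 ≤ cb * n := le_trans (by exact_mod_cast hrm4) hrmc
  have hrm2 : cb * n / 2 ≤ rm := by have h1 : cb * n < rm + 1 := Nat.lt_floor_add_one _; linarith only [h1, hcn4]
  have hrmn : (rm : ℝ) ≤ n / 8 := hrmc.trans (by have := mul_le_mul_of_nonneg_right hc8 hn.le; linarith only [this])
  -- the trivial sub-case `f = 0`
  by_cases hf0 : ∀ z, f z = 0
  · have hφ0 : φ = 0 := by rw [hφ, show f = 0 from funext hf0, mulVec_zero]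
    rw [hφ0]; simp only [Pi.zero_apply, mul_zero, sub_zero, norm_zero, mul_zero]
    positivity
  push Not at hf0
  -- the distance to the support
  set supp : Finset (Balaban1983to89.Site P 0) := univ.filter fun w => f w ≠ 0 with hsuppdef
  have hne : supp.Nonempty := by obtain ⟨w, hw⟩ := hf0; exact ⟨w, by rw [hsuppdef, mem_filter]; exact ⟨mem_univ _, hw⟩⟩
  have hmem : ∀ {w}, f w ≠ 0 → w ∈ supp := fun hw => by rw [hsuppdef, mem_filter]; exact ⟨mem_univ _, hw⟩
  set Df : Balaban1983to89.Site P 0 → ℕ := fun z => supp.inf' hne fun w => supDist z w with hDf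
  have hDf_le : ∀ z w, f w ≠ 0 → Df z ≤ supDist z w := fun z w hw => Finset.inf'_le _ (hmem hw)
  have hDf_ex : ∀ z, ∃ w, f w ≠ 0 ∧ Df z = supDist z w := fun z => by
    obtain ⟨w, hw, h⟩ := Finset.exists_mem_eq_inf' hne (fun w => supDist z w)
    rw [hsuppdef, mem_filter] at hw
    exact ⟨w, hw.2, h⟩
  have hDf_tri : ∀ y z, Df y ≤ supDist y z + Df z := fun y z => by
    obtain ⟨w, hw, h⟩ := hDf_ex z
    rw [h]
    exact (hDf_le y w hw).trans (supDist_triangle y z w)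
  -- the depth in the cube (distance to the complement; `L^k` if the complement is empty)
  set Qc : Finset (Balaban1983to89.Site P 0) := univ.filter fun w => w ∉ Q with hQcdef
  set dep : Balaban1983to89.Site P 0 → ℕ := fun z => if hq : Qc.Nonempty then Qc.inf' hq (fun w => supDist z w) else P.L ^ k
    with hdepdef
  have hdep_app : ∀ z, dep z = if hq : Qc.Nonempty then Qc.inf' hq (fun w => supDist z w) else P.L ^ k := fun z => rfl
  have hdep_le : ∀ z w, w ∉ Q → dep z ≤ supDist z w := by
    intro z w hw
    have hwQc : w ∈ Qc := by rw [hQcdef, mem_filter]; exact ⟨mem_univ _, hw⟩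
    have hq : Qc.Nonempty := ⟨w, hwQc⟩
    rw [hdep_app, dif_pos hq]
    exact Finset.inf'_le _ hwQc
  have hdep_in : ∀ z w, supDist z w < dep z → w ∈ Q := fun z w h => by
    by_contra hw
    exact absurd (hdep_le z w hw) (not_le.2 h)
  have hdep_tri : ∀ y z, dep y ≤ supDist y z + dep z := by
    intro y z
    by_cases hq : Qc.Nonempty
    · obtain ⟨w, hw, h⟩ := Finset.exists_mem_eq_inf' hq (fun w => supDist z w)
      have hwQ : w ∉ Q := by rw [hQcdef, mem_filter] at hw; exact hw.2
      have h1 : dep z = supDist z w := by rw [hdep_app, dif_pos hq]; exact h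
      rw [h1]
      exact (hdep_le y w hwQ).trans (supDist_triangle y z w)
    · rw [hdep_app y, hdep_app z, dif_neg hq, dif_neg hq]; omega
  have hdep_x : (n : ℝ) ≤ dep x := by
    rw [← hncast]
    have h1 : P.L ^ k ≤ dep x := by
      by_cases hq : Qc.Nonempty
      · rw [hdep_app, dif_pos hq]
        refine Finset.le_inf' _ _ fun w hw => hdeep w ?_
        rw [hQcdef, mem_filter] at hw; exact hw.2
      · rw [hdep_app, dif_neg hq]
    exact_mod_cast h1
  -- the admissible half-radius `ρ(z) = (depth − 2)/2` and the depth weight `W(z) = min(rm, max(0, ρ))/rm`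
  set ρf : Balaban1983to89.Site P 0 → ℝ := fun z => ((dep z : ℝ) - 2) / 2 with hρfdef
  have hρf_app : ∀ z, ρf z = ((dep z : ℝ) - 2) / 2 := fun z => rfl
  set W : Balaban1983to89.Site P 0 → ℝ := fun z => min (rm : ℝ) (max 0 (ρf z)) / rm with hWdef
  have hW_app : ∀ z, W z = min (rm : ℝ) (max 0 (ρf z)) / rm := fun z => rfl
  have hW01 : ∀ z, 0 ≤ W z ∧ W z ≤ 1 := fun z => by rw [hW_app]; exact weight_mem hrm0
  -- the weighted maximum over bonds
  set g : PBond P 0 → ℝ := fun b => W b.src * (Real.exp (t * Df b.src / n) * ‖cfg U b * φ b.tgt - φ b.src‖) with hgdef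
  have hg_app : ∀ (z : Balaban1983to89.Site P 0) (ν : Fin P.d),
      g ⟨z, ν⟩ = W z * (Real.exp (t * Df z / n) * ‖cfg U ⟨z, ν⟩ * φ (z.shift ν) - φ z‖) := fun z ν => rfl
  obtain ⟨b₀, -, hb₀⟩ := exists_max_image (univ : Finset (PBond P 0)) g ⟨⟨x, μ⟩, mem_univ _⟩
  obtain ⟨y₀, μ₀⟩ := b₀
  set Mx : ℝ := g ⟨y₀, μ₀⟩ with hMxdef
  have hMb : ∀ (z : Balaban1983to89.Site P 0) (ν : Fin P.d), g ⟨z, ν⟩ ≤ Mx := fun z ν => hb₀ ⟨z, ν⟩ (mem_univ _)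
  have hMxeq : Mx = W y₀ * (Real.exp (t * Df y₀ / n) * ‖cfg U ⟨y₀, μ₀⟩ * φ (y₀.shift μ₀) - φ y₀‖) := by rw [hMxdef, hg_app]
  have hM0 : 0 ≤ Mx := by rw [hMxeq]; exact mul_nonneg (hW01 _).1 (by positivity)
  -- how the weighted maximum controls a covariant difference
  have hMuse : ∀ (z : Balaban1983to89.Site P 0) (ν : Fin P.d),
      W z * ‖cfg U ⟨z, ν⟩ * φ (z.shift ν) - φ z‖ ≤ Mx * Real.exp (-(t * Df z / n)) := by
    intro z ν
    have h1 := hMb z ν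
    rw [hg_app] at h1
    have h2 : Real.exp (t * Df z / n) * Real.exp (-(t * Df z / n)) = 1 := by rw [← Real.exp_add, add_neg_cancel, Real.exp_zero]
    calc W z * ‖cfg U ⟨z, ν⟩ * φ (z.shift ν) - φ z‖
        = W z * ‖cfg U ⟨z, ν⟩ * φ (z.shift ν) - φ z‖ * (Real.exp (t * Df z / n) * Real.exp (-(t * Df z / n))) := by
          rw [h2, mul_one]
      _ = (W z * (Real.exp (t * Df z / n) * ‖cfg U ⟨z, ν⟩ * φ (z.shift ν) - φ z‖)) * Real.exp (-(t * Df z / n)) := by ring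
      _ ≤ Mx * Real.exp (-(t * Df z / n)) := mul_le_mul_of_nonneg_right h1 (Real.exp_pos _).le
  -- REDUCTION: it suffices to bound the weighted maximum, `Mx ≤ C·L^kε²F`, since the weight of the target bond is `1`
  have hWx : W x = 1 := by
    have hρx : (rm : ℝ) ≤ ρf x := by
      rw [hρf_app, le_div_iff₀ (by norm_num : (0:ℝ) < 2)]
      linarith only [hdep_x, hrmn, hn3]
    rw [hW_app, max_eq_right (hrm0.le.trans hρx), min_eq_left hρx, div_self hrm0.ne']
  have hDx : D ≤ (Df x : ℝ) := by
    obtain ⟨w, hw, h⟩ := hDf_ex x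
    rw [h]; exact hsupp w hw
  suffices hMfin : Mx ≤ (2 * C_L * K₁ + 32 * e * c_v / cb) * (n * P.eps ^ 2 * F) by
    have hδx : ‖cfg U ⟨x, μ⟩ * φ (x.shift μ) - φ x‖ ≤
        (2 * C_L * K₁ + 32 * e * c_v / cb) * (n * P.eps ^ 2 * F) * Real.exp (-(t * D / n)) := by
      have h1 := hMuse x μ
      rw [hWx, one_mul] at h1
      exact h1.trans (mul_le_mul hMfin (hexpD hDx) (Real.exp_pos _).le (by positivity))
    calc P.eps⁻¹ * ‖cfg U ⟨x, μ⟩ * φ (x.shift μ) - φ x‖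
        ≤ P.eps⁻¹ * ((2 * C_L * K₁ + 32 * e * c_v / cb) * (n * P.eps ^ 2 * F) * Real.exp (-(t * D / n))) :=
          mul_le_mul_of_nonneg_left hδx (inv_nonneg.2 hε.le)
      _ = (2 * C_L * K₁ + 32 * e * c_v / cb) * P.spacing k * Real.exp (-(t * D / n)) * F := by rw [hsp]; field_simp
      _ ≤ _ := mul_le_mul_of_nonneg_right (mul_le_mul_of_nonneg_right (mul_le_mul_of_nonneg_right (lt_add_one _).le hsp0.le)
          (Real.exp_pos _).le) hF0
  ----------------------------------------------------------------------------------------------------------------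
  -- THE BOUND ON THE WEIGHTED MAXIMUM, at the maximal bond `⟨y₀, y₀ + e_{μ₀}⟩`
  set D₀ : ℝ := (Df y₀ : ℝ) with hD₀
  set E : ℝ := Real.exp (-(t * D₀ / n)) with hEdef
  have hE0 : 0 < E := Real.exp_pos _
  have hEinv : Real.exp (t * D₀ / n) * E = 1 := by rw [hEdef, ← Real.exp_add, add_neg_cancel, Real.exp_zero]
  set W₀ : ℝ := W y₀ with hW₀def
  have hW₀_app : W₀ = min (rm : ℝ) (max 0 (ρf y₀)) / rm := hW_app y₀
  set ρ₀ : ℝ := ρf y₀ with hρ₀def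
  have hρ₀_app : ρ₀ = ((dep y₀ : ℝ) - 2) / 2 := hρf_app y₀
  by_cases hρ8 : ρ₀ < 8
  · ----------------------------------------------------------------------------------------------------------------
    -- SHALLOW MAXIMAL BOND (depth `< 18`): weight `< 8/rm ≤ 16/(cb·n)`, two values of `φ`
    have hW₀le : W₀ ≤ 8 / rm := by
      rw [hW₀_app]
      refine div_le_div_of_nonneg_right ((min_le_right _ _).trans (max_le (by norm_num) hρ8.le)) hrm0.le
    have hδ₀ := htwo y₀ μ₀ D₀ (fun z hz => by rw [hD₀]; exact_mod_cast hDf_le y₀ z hz)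
    have h1 : Mx ≤ (8 / rm) * (2 * e * c_v * P.spacing k ^ 2 * F) := by
      rw [hMxeq]
      have h2 : Real.exp (t * D₀ / n) * ‖cfg U ⟨y₀, μ₀⟩ * φ (y₀.shift μ₀) - φ y₀‖ ≤ 2 * e * c_v * P.spacing k ^ 2 * F := by
        calc Real.exp (t * D₀ / n) * ‖cfg U ⟨y₀, μ₀⟩ * φ (y₀.shift μ₀) - φ y₀‖
            ≤ Real.exp (t * D₀ / n) * (2 * e * c_v * P.spacing k ^ 2 * Real.exp (-(t * D₀ / n)) * F) :=
              mul_le_mul_of_nonneg_left hδ₀ (Real.exp_pos _).le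
          _ = 2 * e * c_v * P.spacing k ^ 2 * F * (Real.exp (t * D₀ / n) * E) := by rw [hEdef]; ring
          _ = 2 * e * c_v * P.spacing k ^ 2 * F := by rw [hEinv, mul_one]
      exact mul_le_mul hW₀le h2 (by positivity) (by positivity)
    have h3 := shallow_step (sp := P.spacing k) hrm0 hc0 hn he0.le hc_v.le hF0 hrm2 hsp
    have h6 : 0 ≤ 2 * C_L * K₁ * (n * P.eps ^ 2 * F) := by positivity
    linarith only [h1, h3, h6]
  ----------------------------------------------------------------------------------------------------------------
  -- DEEP MAXIMAL BOND (`ρ₀ ≥ 8`): the interior estimate on the ball of half the admissible radius, and absorption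
  push Not at hρ8
  have hρ₀0 : 0 ≤ ρ₀ := by linarith only [hρ8]
  have hW₀pos : 0 < W₀ := by
    rw [hW₀_app]
    exact div_pos (lt_min hrm0 (lt_max_of_lt_right (by linarith only [hρ8]))) hrm0
  have hW₀1 : W₀ ≤ 1 := (hW01 y₀).2
  have hdep₀ : (18 : ℝ) ≤ dep y₀ := by linarith only [hρ8, hρ₀_app]
  -- the working radius `r = min(rm, ⌊ρ₀/2⌋)`
  set r : ℕ := min rm ⌊ρ₀ / 2⌋₊ with hrdef
  have hfl : (⌊ρ₀ / 2⌋₊ : ℝ) ≤ ρ₀ / 2 := Nat.floor_le (by positivity)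
  have hfl' : ρ₀ / 2 - 1 ≤ (⌊ρ₀ / 2⌋₊ : ℝ) := by have := Nat.lt_floor_add_one (ρ₀ / 2); linarith only [this]
  have hfl4 : 4 ≤ ⌊ρ₀ / 2⌋₊ := Nat.le_floor (by push_cast; linarith only [hρ8])
  have hr4 : 4 ≤ r := le_min hrm4 hfl4
  have hr0 : (0 : ℝ) < r := by exact_mod_cast (show 0 < r by omega)
  have hrrm : r ≤ rm := min_le_left _ _
  have hrrmR : (r : ℝ) ≤ rm := by exact_mod_cast hrrm
  have hrc : (r : ℝ) ≤ cb * n := hrrmR.trans hrmc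
  have hrn : (r : ℝ) ≤ n / 8 := hrrmR.trans hrmn
  have hrρ : (r : ℝ) ≤ ρ₀ / 2 := by
    have h1 : (r : ℝ) ≤ (⌊ρ₀ / 2⌋₊ : ℝ) := by exact_mod_cast (min_le_right _ _ : r ≤ ⌊ρ₀ / 2⌋₊)
    exact h1.trans hfl
  have hrlow : min (rm : ℝ) ρ₀ / 4 ≤ r := by
    have h1 : ((r : ℕ) : ℝ) = min (rm : ℝ) (⌊ρ₀ / 2⌋₊ : ℝ) := by rw [hrdef]; push_cast; rfl
    rw [h1]
    exact (min_div_four_le hrm0.le (by linarith only [hρ8])).trans (min_le_min le_rfl hfl')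
  have hN : 4 * r + 6 ≤ P.sitesPerDir 0 := by
    have h1 := two_mul_pow_le_sitesPerDir (P := P) hk
    have h2 : 8 * (r : ℝ) ≤ (P.L ^ k : ℕ) := by rw [hncast]; linarith only [hrn]
    have h3 : 8 * r ≤ P.L ^ k := by exact_mod_cast h2
    omega
  -- every site within `2r + 1` of `y₀` lies in the cube
  have hball : ∀ z, supDist y₀ z ≤ 2 * r + 1 → z ∈ Q := by
    intro z hz
    refine hdep_in y₀ z ?_
    have h1 : ((supDist y₀ z : ℕ) : ℝ) ≤ 2 * r + 1 := by exact_mod_cast hz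
    have h2 : (2 * r + 1 : ℝ) < dep y₀ := by linarith only [hrρ, hdep₀, hρ₀_app]
    exact_mod_cast h1.trans_lt h2
  -- the depth weight on the `2r`-ball is at least `W₀/2`
  have hWball : ∀ z, supDist y₀ z ≤ 2 * r → W₀ / 2 ≤ W z := by
    intro z hz
    have h1 : ((supDist y₀ z : ℕ) : ℝ) ≤ 2 * r := by exact_mod_cast hz
    have h2 : ((dep y₀ : ℕ) : ℝ) ≤ supDist y₀ z + dep z := by exact_mod_cast hdep_tri y₀ z
    have h3 : ρ₀ / 2 ≤ ρf z := by rw [hρf_app]; linarith only [h1, h2, hrρ, hρ₀_app]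
    have h4 : min (rm : ℝ) (max 0 ρ₀) / 2 ≤ min (rm : ℝ) (max 0 (ρf z)) := by
      refine (min_div_two_le hrm0.le).trans (min_le_min le_rfl ?_)
      rw [max_eq_right hρ₀0]
      exact le_max_of_le_right h3
    rw [hW₀_app, hW_app, div_div, div_le_div_iff₀ (by positivity) hrm0]
    have h5 := mul_le_mul_of_nonneg_right h4 (by positivity : (0:ℝ) ≤ (rm : ℝ) * 2)
    linarith only [h5]
  -- the local exponential slack factors
  have hslack1 : Real.exp (t * (2 * r) / n) ≤ e := by
    rw [hedef]; refine Real.exp_le_exp.2 ?_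
    rw [div_le_one hn]
    have h1 : t * (2 * r) ≤ 1 * (2 * r) := mul_le_mul_of_nonneg_right ht1 (by positivity)
    linarith only [h1, hrn]
  have hslack3 : Real.exp (t * (2 * r + n + 1) / n) ≤ e ^ 3 := by
    rw [hedef, ← Real.exp_nat_mul]; refine Real.exp_le_exp.2 ?_
    rw [div_le_iff₀ hn]
    have h1 : t * (2 * r + n + 1) ≤ 1 * (2 * r + n + 1) := mul_le_mul_of_nonneg_right ht1 (by positivity)
    push_cast
    linarith only [h1, hrn, hn1]
  -- the gauge, the gauge copy, its source in the TORUS problem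
  set hg := BIJ85CentredAxialGauge.centredGauge U y₀ (2 * r) with hhg
  set U' := GaugeField.gaugeAct hg U with hU'
  set ψ : Balaban1983to89.Site P 0 → ℂ := fun z => toC (hg z) * φ z with hψdef
  set f' : Balaban1983to89.Site P 0 → ℂ := nOp a' P.eps⁻¹ U' k univ *ᵥ ψ with hf'def
  have hψeq : nOp a' P.eps⁻¹ U' k univ *ᵥ ψ = f' := rfl
  have hnormψ : ∀ z, ‖ψ z‖ = ‖φ z‖ := fun z => by rw [show ψ z = toC (hg z) * φ z from rfl, norm_mul, norm_toC, one_mul]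
  have hcov : ∀ z ν, ‖cfg U' ⟨z, ν⟩ * ψ (z.shift ν) - ψ z‖ = ‖cfg U ⟨z, ν⟩ * φ (z.shift ν) - φ z‖ := fun z ν =>
    norm_covDiff_gaugeAct hg U φ z ν
  -- the source of the torus problem agrees with `h·f` on the `2r`-ball (its bonds lie in the cube)
  have hf'eq : ∀ z, supDist y₀ z ≤ 2 * r → f' z = toC (hg z) * f z := by
    intro z hz
    have hzQ : z ∈ Q := hball z (by omega)
    have hsQ : ∀ ν, z.shift ν ∈ Q := fun ν => hball _ ((supDist_shift_le_succ y₀ z ν).trans (by omega))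
    have huQ : ∀ ν, z.unshift ν ∈ Q := fun ν => hball _ ((supDist_unshift_le_succ y₀ z ν).trans (by omega))
    rw [← hψeq, nOp_univ_mulVec_apply_eq_of_interior a' P.eps⁻¹ U' hΩ ψ hzQ hsQ huQ]
    exact nOp_gaugeAct_mulVec_apply hk0 hc' ha' hg U hΩ f hzQ
  set γ : ℝ := ((P.d - 1 : ℕ) : ℝ) * θ with hγdef
  have hγ0 : 0 ≤ γ := by positivity
  have hγn : γ * n ^ 2 ≤ 1 := gamma_nsq_le_one hθ0 hd1' hsmall
  have hgauge : ∀ z ν, supDist y₀ z ≤ 2 * r → ‖cfg U' ⟨z, ν⟩ - 1‖ ≤ γ * supDist y₀ z := by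
    intro z ν hz
    have hR : 2 * (2 * r) + 4 < P.sitesPerDir 0 := by omega
    have h1 := BIJ85CentredAxialGauge.dist1_centredGauge_le U hθ0 hplaq' y₀ hR z hz ν
    rw [BIJ88Smooth43Axial.dist1_eq_norm_toC_sub_one] at h1
    calc ‖cfg U' ⟨z, ν⟩ - 1‖ = ‖toC (GaugeField.gaugeAct hg U ⟨z, ν⟩) - 1‖ := rfl
      _ ≤ ((P.d - 1 : ℕ) : ℝ) * (supDist y₀ z : ℝ) * θ := h1
      _ = γ * supDist y₀ z := by rw [hγdef]; ring
  -- the local data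
  set S₀ : ℝ := c_v * P.spacing k ^ 2 * F * e ^ 3 with hS₀def
  set S : ℝ := S₀ * E with hSdef
  have hS0 : 0 ≤ S := by positivity
  have hSψ : ∀ z, supDist y₀ z ≤ 2 * r + P.L ^ k + 1 → ‖ψ z‖ ≤ S := by
    intro z hz
    rw [hnormψ]
    have hsup : ∀ w, f w ≠ 0 → max (D₀ - supDist y₀ z) 0 ≤ (supDist z w : ℝ) := fun w hw => by
      refine max_le ?_ (Nat.cast_nonneg _)
      have h1 := (hDf_le y₀ w hw).trans (supDist_triangle y₀ z w)
      have : ((Df y₀ : ℕ) : ℝ) ≤ ((supDist y₀ z + supDist z w : ℕ) : ℝ) := by exact_mod_cast h1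
      push_cast at this; rw [hD₀]; linarith only [this]
    refine (hvalP z f F _ hF hsup).trans ?_
    have h2 : Real.exp (-(t₁ * max (D₀ - supDist y₀ z) 0 / n)) ≤ E * e ^ 3 := by
      refine ((hexp_t₁ (le_max_right _ _)).trans (hexpD (le_max_left _ _))).trans ?_
      have hz' : (supDist y₀ z : ℝ) ≤ 2 * r + n + 1 := by
        have : ((supDist y₀ z : ℕ) : ℝ) ≤ ((2 * r + P.L ^ k + 1 : ℕ) : ℝ) := by exact_mod_cast hz
        push_cast at this; rw [hndef]; exact this
      calc Real.exp (-(t * (D₀ - supDist y₀ z) / n)) = E * Real.exp (t * supDist y₀ z / n) := by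
            rw [hEdef, ← Real.exp_add]; congr 1; ring
        _ ≤ E * Real.exp (t * (2 * r + n + 1) / n) := by
            refine mul_le_mul_of_nonneg_left (Real.exp_le_exp.2 ?_) hE0.le
            exact div_le_div_of_nonneg_right (mul_le_mul_of_nonneg_left hz' ht.le) hn.le
        _ ≤ E * e ^ 3 := mul_le_mul_of_nonneg_left hslack3 hE0.le
    calc c_v * P.spacing k ^ 2 * Real.exp (-(t₁ * max (D₀ - ↑(supDist y₀ z)) 0 / n)) * F
        ≤ c_v * P.spacing k ^ 2 * (E * e ^ 3) * F := by gcongr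
      _ = S := by rw [hSdef, hS₀def]; ring
  set Mloc : ℝ := 2 * Mx * E * e / W₀ with hMlocdef
  have hMloc0 : 0 ≤ Mloc := by positivity
  have hMψ : ∀ z ν, supDist y₀ z ≤ 2 * r → ‖cfg U' ⟨z, ν⟩ * ψ (z.shift ν) - ψ z‖ ≤ Mloc := by
    intro z ν hz
    rw [hcov]
    have hWz : W₀ / 2 ≤ W z := hWball z hz
    have hWz0 : 0 < W z := lt_of_lt_of_le (by positivity) hWz
    have h1 : Real.exp (-(t * Df z / n)) ≤ E * e := by
      have h2 : (D₀ - 2 * r : ℝ) ≤ Df z := by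
        have h3 : ((Df y₀ : ℕ) : ℝ) ≤ ((supDist y₀ z + Df z : ℕ) : ℝ) := by exact_mod_cast hDf_tri y₀ z
        have h4 : ((supDist y₀ z : ℕ) : ℝ) ≤ ((2 * r : ℕ) : ℝ) := by exact_mod_cast hz
        push_cast at h3 h4; rw [hD₀]; linarith only [h3, h4]
      refine (hexpD h2).trans ?_
      calc Real.exp (-(t * (D₀ - 2 * r) / n)) = E * Real.exp (t * (2 * r) / n) := by rw [hEdef, ← Real.exp_add]; congr 1; ring
        _ ≤ E * e := mul_le_mul_of_nonneg_left hslack1 hE0.le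
    have h5 : W z * ‖cfg U ⟨z, ν⟩ * φ (z.shift ν) - φ z‖ ≤ Mx * (E * e) := (hMuse z ν).trans (mul_le_mul_of_nonneg_left h1 hM0)
    rw [← le_div_iff₀' hWz0] at h5
    refine h5.trans ?_
    rw [hMlocdef, div_le_div_iff₀ hWz0 hW₀pos]
    have h6 : 0 ≤ Mx * (E * e) := by positivity
    have h7 : Mx * (E * e) * (W₀ / 2) ≤ Mx * (E * e) * W z := mul_le_mul_of_nonneg_left hWz h6
    linarith only [h7]
  set Floc : ℝ := F * E * e with hFlocdef
  have hFloc0 : 0 ≤ Floc := by positivity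
  have hFf' : ∀ z, supDist y₀ z ≤ 2 * r → ‖f' z‖ ≤ Floc := by
    intro z hz
    rw [hf'eq z hz, norm_mul, norm_toC, one_mul]
    by_cases hfz : f z = 0
    · rw [hfz, norm_zero]; exact hFloc0
    · have h1 : D₀ ≤ 2 * r := by
        have := (hDf_le y₀ z hfz).trans hz
        have h2 : ((Df y₀ : ℕ) : ℝ) ≤ ((2 * r : ℕ) : ℝ) := by exact_mod_cast this
        push_cast at h2; rw [hD₀]; exact h2
      have h2 : 1 ≤ E * e := by
        have h3 : Real.exp (-(t * (2 * r) / n)) ≤ E := hexpD h1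
        have h4 : Real.exp (-(t * (2 * r) / n)) * Real.exp (t * (2 * r) / n) = 1 := by
          rw [← Real.exp_add, neg_add_cancel, Real.exp_zero]
        calc (1 : ℝ) = Real.exp (-(t * (2 * r) / n)) * Real.exp (t * (2 * r) / n) := h4.symm
          _ ≤ E * e := mul_le_mul h3 hslack1 (Real.exp_pos _).le hE0.le
      calc ‖f z‖ ≤ F := hF z
        _ = F * 1 := (mul_one F).symm
        _ ≤ F * (E * e) := mul_le_mul_of_nonneg_left h2 hF0
        _ = Floc := by rw [hFlocdef]; ring
  -- THE LOCAL ESTIMATE (flat kernel envelopes in the torus dimension `P.d = d + 1`)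
  have hK1 : ∀ z, |(B1RG242Torus.tower P a 0).G k (y₀.shift μ₀) z - (B1RG242Torus.tower P a 0).G k y₀ z| ≤
      C_K * P.eps ^ 2 / (max (supDist y₀ z : ℝ) 1) ^ (P.d - 1) := fun z => by
    rw [hPd, Nat.add_sub_cancel]
    have h := hkerP.1 μ₀ y₀ z
    rwa [Nat.add_sub_cancel] at h
  have hK2 : ∀ (ν : Fin P.d) z, |(B1RG242Torus.tower P a 0).G k (y₀.shift μ₀) (z.shift ν) -
      (B1RG242Torus.tower P a 0).G k (y₀.shift μ₀) z - (B1RG242Torus.tower P a 0).G k y₀ (z.shift ν) +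
      (B1RG242Torus.tower P a 0).G k y₀ z| ≤ C_K * P.eps ^ 2 / (max (supDist y₀ z : ℝ) 1) ^ P.d := fun ν z => by
    rw [hPd]
    exact hkerP.2 μ₀ ν y₀ z
  have hmain := hloc P hPd ha hk1 hkK hr4 hN y₀ μ₀ U' ψ f' hψeq hγ0 hS0 hMloc0 hFloc0 hK1 hK2 hgauge hSψ hMψ hFf'
  -- its left-hand side is `Mx·E/W₀`
  have hLHS : ‖ψ (y₀.shift μ₀) - ψ y₀‖ = Mx * E / W₀ := by
    have hu1 : cfg U' ⟨y₀, μ₀⟩ = 1 := by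
      have h1 := hgauge y₀ μ₀ (by rw [(supDist_eq_zero_iff y₀ y₀).2 rfl]; exact Nat.zero_le _)
      rw [(supDist_eq_zero_iff y₀ y₀).2 rfl, Nat.cast_zero, mul_zero] at h1
      exact sub_eq_zero.1 (norm_le_zero_iff.1 h1)
    have h2 : ‖ψ (y₀.shift μ₀) - ψ y₀‖ = ‖cfg U ⟨y₀, μ₀⟩ * φ (y₀.shift μ₀) - φ y₀‖ := by rw [← hcov, hu1, one_mul]
    rw [h2, eq_div_iff hW₀pos.ne', hMxeq]
    calc ‖cfg U ⟨y₀, μ₀⟩ * φ (y₀.shift μ₀) - φ y₀‖ * W₀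
        = W₀ * (‖cfg U ⟨y₀, μ₀⟩ * φ (y₀.shift μ₀) - φ y₀‖ * (Real.exp (t * D₀ / n) * E)) := by rw [hEinv]; ring
      _ = W₀ * (Real.exp (t * D₀ / n) * ‖cfg U ⟨y₀, μ₀⟩ * φ (y₀.shift μ₀) - φ y₀‖) * E := by ring
  rw [hLHS] at hmain
  -- `γ r² ≤ cb²`, the contraction factor `2·C_L·e·γ r² ≤ 1/2`
  have hγr : γ * (r : ℝ) ^ 2 ≤ cb ^ 2 := by
    calc γ * (r : ℝ) ^ 2 ≤ γ * (cb * n) ^ 2 := mul_le_mul_of_nonneg_left (pow_le_pow_left₀ hr0.le hrc 2) hγ0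
      _ = cb ^ 2 * (γ * n ^ 2) := by ring
      _ ≤ cb ^ 2 * 1 := mul_le_mul_of_nonneg_left hγn (sq_nonneg cb)
      _ = cb ^ 2 := mul_one _
  have hκ : C_L * (γ * (r : ℝ) ^ 2) * (2 * e) ≤ 1 / 2 := by
    calc C_L * (γ * (r : ℝ) ^ 2) * (2 * e) ≤ C_L * cb ^ 2 * (2 * e) := by gcongr
      _ = 2 * ((C_L * e * cb) * cb) := by ring
      _ ≤ 2 * ((1 / 4) * 1) := by
          refine mul_le_mul_of_nonneg_left (mul_le_mul hcC hc1 hc0.le (by norm_num)) (by norm_num)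
      _ = 1 / 2 := by norm_num
  -- absorb: `Mx ≤ 2·C_L·W₀·(F e ε² r + (γ r + 1/r + α ε²(r + n))·S₀)`
  have hmain' : Mx * E / W₀ ≤ C_L * ((F * E * e) * P.eps ^ 2 * r + γ * r ^ 2 * (2 * Mx * E * e / W₀) + γ * r * (S₀ * E) +
      (S₀ * E) / r + B1RG242Torus.α P a k * P.eps ^ 2 * (r + n) * (S₀ * E)) := by
    have h := hmain
    rw [hFlocdef, hMlocdef, hSdef] at h
    exact h
  have hM_le := absorb_step hE0 hW₀pos hM0 hr0 hκ hmain'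
  -- the budget of the absorbed terms
  have hWr : W₀ / r ≤ 8 / (cb * n) := by
    have h1 : W₀ / r ≤ 4 / rm := by
      rw [div_le_div_iff₀ hr0 hrm0]
      have h2 : W₀ * (rm : ℝ) = min (rm : ℝ) (max 0 ρ₀) := by rw [hW₀_app]; field_simp
      rw [h2, max_eq_right hρ₀0]
      linarith only [hrlow]
    have h4 : 4 / (rm : ℝ) ≤ 8 / (cb * n) := by
      rw [div_le_div_iff₀ hrm0 (by positivity)]; linarith only [hrm2]
    exact h1.trans h4
  have hbudget := budget_step hW₀1 hF0 he0.le hr0 hγ0 hc0 hn hc_v.le hα.le ha.le hrc hrn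
    hγn hWr hαa hsp
  have h7 : 0 ≤ 32 * e * c_v / cb * (n * P.eps ^ 2 * F) := by positivity
  have h8 : C_L * W₀ * (F * e * P.eps ^ 2 * r + (γ * r + 1 / r + B1RG242Torus.α P a k * P.eps ^ 2 * (r + n)) * S₀) ≤
      C_L * (K₁ * (n * P.eps ^ 2 * F)) := by
    rw [mul_assoc C_L]
    refine mul_le_mul_of_nonneg_left ?_ hCL.le
    rw [hS₀def, hK₁]
    exact hbudget
  linarith only [hM_le, h8, h7]


end Main

/-! ## §3 The (H1.10″)-type input shape, and the members under (7.3.1)-TYPE plaquette smallness only (blockwise centred gauge), every block union -/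

section Corollaries

variable {d : ℕ}

open BIJ85CentredAxialGauge (centredGauge)
open BIJ88NeumannPropagatorSmallPlaquetteRegion (smallField_blockGauge)

/-- **§2 IN THE INPUT SHAPE** (r01's `input110_deriv_regular_deep` binder: distance `B5Ineq137Torus.T`, one power of the spacing, rate
`e^{−t₀(L^k)^{−1}D}`, deep rows as the ball condition `T(x,y) < L^k → y ∈ Ω`): for the region propagator at a field with the bondwise `(T, δ)`
hypotheses inside `Ω` and plaquettes within `θ` of `1` (`2d³(L^{2k}θ)² ≤ 1`), every row `x` whose open `L^k`-ball lies in `Ω`, every `f` with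
`|f| ≤ F` vanishing at sup-distance `< D` from `x`, every direction `μ`: `‖(D_uG_k(Ω,u)f)(⟨x, x+e_μ⟩)‖ ≤ (L^kε)·(c₁e^{−t₀(L^k)^{−1}D}F)` — the
covariant-derivative twin of gen 18's `decay110_smallField_region_input`.
[cite: BalabanImbrieJaffe1985, (7.3.1) p.326; Balaban1983RegularityDecay, (1.10) p.573] -/
theorem decay110_smallField_region_deriv_input (d L : ℕ) (hd1 : 1 ≤ d) (hd3 : d + 1 ≤ 3) (hL : Odd L ∧ 1 < L) {a : ℝ} (ha : 0 < a) :
    ∃ t₀ c₁ : ℝ, 0 < t₀ ∧ 0 < c₁ ∧ ∀ (P : Params), P.d = d + 1 → P.L = L →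
      ∀ k : ℕ, 1 ≤ k → k ≤ P.K → ∀ Ω : Finset (Balaban1983to89.Site P 0), IsBlockUnion k Ω →
        ∀ (U : GaugeField P 0 U1) (θ T δ : ℝ), 0 ≤ θ →
          (∀ p : Balaban1983to89.Plaq P 0, ‖toC (GaugeField.plaqHol U p) - 1‖ ≤ θ) →
          2 * (P.d : ℝ) ^ 3 * (((P.L : ℝ) ^ k) ^ 2 * θ) ^ 2 ≤ 1 →
          (∀ b ∈ starB Ω, blkIter k b.src = blkIter k b.tgt → ‖toC (U b) - 1‖ ≤ T) →
          (∀ y ∈ Ω, ‖holCK U k y - 1‖ ≤ δ) →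
          2 * (((P.L : ℝ) ^ k - 1) * (P.L : ℝ) ^ k) * P.d * T ^ 2 + 2 * δ ^ 2 ≤ 1 / 2 →
          ∀ (x : Balaban1983to89.Site P 0), (∀ y, B5Ineq137Torus.T P 0 x y < (P.L : ℝ) ^ k → y ∈ Ω) →
          ∀ (f : Balaban1983to89.Site P 0 → ℂ) (F D : ℝ), (∀ y, ‖f y‖ ≤ F) → (∀ y, f y ≠ 0 → D ≤ B5Ineq137Torus.T P 0 x y) →
          ∀ (μ : Fin P.d),
            ‖covD P.eps⁻¹ (cfg U) (gBox (B1RG242Torus.α P a k * (P.L : ℝ) ^ (k * P.d)) P.eps⁻¹ U k Ω *ᵥ f) ⟨x, μ⟩‖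
              ≤ P.spacing k * (c₁ * Real.exp (-(t₀ * (((P.L : ℝ) ^ k)⁻¹ * D))) * F) := by
  obtain ⟨t₀, c₁, ht₀, hc₁, H⟩ := decay110_smallField_region_deriv d L hd1 hd3 hL ha
  refine ⟨t₀, c₁, ht₀, hc₁, ?_⟩
  intro P hPd hPL k hk1 hkK Ω hΩ U θ T δ hθ hplaq hsmall hInt hTree hsmallT x hdeep f F D hF hsupp μ
  have h := H P hPd hPL k hk1 hkK Ω hΩ U θ T δ hθ hplaq hsmall hInt hTree hsmallT x μ f F D hF
    (fun z hz => by rw [← B3Bound323ZeroTorus.T_eq_supDist]; exact hsupp z hz)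
    (fun w hw => by
      by_contra hlt
      exact hw (hdeep w (by rw [B3Bound323ZeroTorus.T_eq_supDist]; exact_mod_cast (not_le.1 hlt))))
  calc _ ≤ c₁ * P.spacing k * Real.exp (-(t₀ * D / (P.L : ℝ) ^ k)) * F := h
    _ = P.spacing k * (c₁ * Real.exp (-(t₀ * (((P.L : ℝ) ^ k)⁻¹ * D))) * F) := by
        rw [show t₀ * D / (P.L : ℝ) ^ k = t₀ * (((P.L : ℝ) ^ k)⁻¹ * D) by ring]; ring

/-- **§2 AT EVERY GAUGE COPY**: if `u` satisfies the hypotheses of `decay110_smallField_region_deriv` (bondwise `(T, δ)` inside `Ω`,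
plaquettes within `θ` of `1`), the bound holds verbatim for `G_k(Ω,u^h)` and `D_{u^h}`, every gauge transformation `h` (the plaquettes and the
modulus of the covariant derivative are gauge invariant; the source is rotated by `h`) — the region analogue of gen 17's
`decay110_smallField_cube_deriv_gaugeAct`. [cite: BalabanImbrieJaffe1985, (2.7) p.303; Balaban1983RegularityDecay, (1.10) p.573] -/
theorem decay110_smallField_region_deriv_gaugeAct (d L : ℕ) (hd1 : 1 ≤ d) (hd3 : d + 1 ≤ 3) (hL : Odd L ∧ 1 < L) {a : ℝ} (ha : 0 < a) :
    ∃ t₀ c₁ : ℝ, 0 < t₀ ∧ 0 < c₁ ∧ ∀ (P : Params), P.d = d + 1 → P.L = L →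
      ∀ k : ℕ, 1 ≤ k → k ≤ P.K → ∀ Ω : Finset (Balaban1983to89.Site P 0), IsBlockUnion k Ω →
        ∀ (U : GaugeField P 0 U1) (θ T δ : ℝ), 0 ≤ θ →
          (∀ p : Balaban1983to89.Plaq P 0, ‖toC (GaugeField.plaqHol U p) - 1‖ ≤ θ) →
          2 * (P.d : ℝ) ^ 3 * (((P.L : ℝ) ^ k) ^ 2 * θ) ^ 2 ≤ 1 →
          (∀ b ∈ starB Ω, blkIter k b.src = blkIter k b.tgt → ‖toC (U b) - 1‖ ≤ T) →
          (∀ y ∈ Ω, ‖holCK U k y - 1‖ ≤ δ) →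
          2 * (((P.L : ℝ) ^ k - 1) * (P.L : ℝ) ^ k) * P.d * T ^ 2 + 2 * δ ^ 2 ≤ 1 / 2 →
          ∀ (h : GaugeTransf P 0 U1) (x : Balaban1983to89.Site P 0) (μ : Fin P.d) (f : Balaban1983to89.Site P 0 → ℂ) (F D : ℝ),
            (∀ z, ‖f z‖ ≤ F) → (∀ z, f z ≠ 0 → D ≤ (supDist x z : ℝ)) →
            (∀ w, w ∉ Ω → P.L ^ k ≤ supDist x w) →
            ‖covD P.eps⁻¹ (cfg (GaugeField.gaugeAct h U)) (gBox (B1RG242Torus.α P a k * (P.L : ℝ) ^ (k * P.d)) P.eps⁻¹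
                (GaugeField.gaugeAct h U) k Ω *ᵥ f) ⟨x, μ⟩‖
              ≤ c₁ * P.spacing k * Real.exp (-(t₀ * D / (P.L : ℝ) ^ k)) * F := by
  obtain ⟨t₀, c₁, ht₀, hc₁, H⟩ := decay110_smallField_region_deriv d L hd1 hd3 hL ha
  refine ⟨t₀, c₁, ht₀, hc₁, ?_⟩
  intro P hPd hPL k hk1 hkK Ω hΩ U θ T δ hθ hplaq hsmall hInt hTree hsmallT h x μ f F D hF hsupp hdeep
  have hk : k ≤ P.m + P.K := hkK.trans (Nat.le_add_left _ _)
  have hk0 : 0 + k ≤ P.m + P.K := by omega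
  have hL1 : (1 : ℝ) < P.L := B1RG242Torus.one_lt_cast_L P
  have ha' : 0 < B1RG242Torus.α P a k * (P.L : ℝ) ^ (k * P.d) :=
    mul_pos (mul_pos (B1.aSeq_pos ha hL1 hk1) (inv_pos.2 (pow_pos (P.spacing_pos k) 2))) (pow_pos P.cast_L_pos _)
  have hc' : P.eps⁻¹ ≠ 0 := inv_ne_zero P.eps_pos.ne'
  -- rotate the source back: `f = h·g` with `g = h̄f`
  set g : Balaban1983to89.Site P 0 → ℂ := fun z => (starRingEnd ℂ) (toC (h z)) * f z with hgdef
  have hgz : ∀ z, g z = (starRingEnd ℂ) (toC (h z)) * f z := fun z => rfl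
  have hfg : f = fun z => toC (h z) * g z := by
    funext z
    rw [hgz, ← mul_assoc, BIJ88NeumannPropagator227Torus.toC_mul_conj, one_mul]
  have hng : ∀ z, ‖g z‖ = ‖f z‖ := fun z => by
    rw [hgz, norm_mul, RCLike.norm_conj, norm_toC, one_mul]
  rw [hfg, norm_covD_gBox_gaugeAct_mulVec hk0 hc' ha' h U hΩ g x μ]
  exact H P hPd hPL k hk1 hkK Ω hΩ U θ T δ hθ hplaq hsmall hInt hTree hsmallT x μ g F D (fun z => by rw [hng]; exact hF z)
    (fun z hz => hsupp z (fun hf => hz (by rw [hgz, hf, mul_zero]))) hdeep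

/-- **THE COVARIANT-DERIVATIVE MEMBER OF [6] (1.10) FOR THE REGION PROPAGATORS ON EVERY `k`-BLOCK UNION UNDER (7.3.1)-TYPE FINE-PLAQUETTE
SMALLNESS ONLY, WITH A THRESHOLD DEPENDING ON `(d, L^k)` ONLY** — uniform in the region, the volume and the field: for `d + 1 ∈ {2, 3}`,
`L` odd `> 1`, `a > 0` there are `t₀, c₁ > 0` (from `(d, L, a)` only) such that for every volume with more than two `k`-blocks per direction
(`2(L^k − 1) + 4 < |T|`), every `1 ≤ k ≤ K`, every `U(1)` field with `|u(∂p) − 1| ≤ θ` for all fine plaquettes and `2(d+1)³(L^{2k}θ)² ≤ 1`,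
every `T ≥ d(L^k − 1)θ` (`d = P.d − 1`) with `2(L^k−1)L^k(d+1)T² + 2((d+1)(L^k−1)T)² ≤ 1/2`, every `k`-block union `Ω`, every bond `⟨x, x+e_μ⟩`
with `dist_∞(x, T∖Ω) ≥ L^k`, every `f` with `|f| ≤ F` vanishing at sup-distance `< D` from `x`:
`|(D_uG_k(Ω,u)f)(⟨x, x+e_μ⟩)| ≤ c₁(L^kε)e^{−t₀D/L^k}F`
— NO gauge condition.  PROOF: §2 for `u^h` in the blockwise centred gauge (`smallField_blockGauge`), the plaquettes and the modulus of the
covariant derivative being gauge invariant (`norm_toC_plaqHol_gaugeAct_sub_one`, `norm_covD_gBox_gaugeAct_mulVec`) — the region analogue of gen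
17's `decay110_smallPlaquette_cube_deriv_uniform`.  HONEST SCOPE: fine-plaquette smallness of `u`, not the printed unit-lattice (7.3.1) (p33's
lane for the passage). [cite: BalabanImbrieJaffe1985, (7.3.1)–(7.3.2) p.326; Balaban1983RegularityDecay, (1.10) p.573] -/
theorem decay110_smallPlaquette_region_deriv_uniform (d L : ℕ) (hd1 : 1 ≤ d) (hd3 : d + 1 ≤ 3) (hL : Odd L ∧ 1 < L) {a : ℝ} (ha : 0 < a) :
    ∃ t₀ c₁ : ℝ, 0 < t₀ ∧ 0 < c₁ ∧ ∀ (P : Params), P.d = d + 1 → P.L = L →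
      ∀ k : ℕ, 1 ≤ k → k ≤ P.K → 2 * (P.L ^ k - 1) + 4 < P.sitesPerDir 0 →
      ∀ (U : GaugeField P 0 U1) (θ : ℝ), 0 ≤ θ →
        (∀ p : Balaban1983to89.Plaq P 0, ‖toC (GaugeField.plaqHol U p) - 1‖ ≤ θ) →
        2 * (P.d : ℝ) ^ 3 * (((P.L : ℝ) ^ k) ^ 2 * θ) ^ 2 ≤ 1 →
        ∀ (T : ℝ), ((P.d - 1 : ℕ) : ℝ) * ((P.L : ℝ) ^ k - 1) * θ ≤ T →
          2 * (((P.L : ℝ) ^ k - 1) * (P.L : ℝ) ^ k) * P.d * T ^ 2 + 2 * (P.d * ((P.L : ℝ) ^ k - 1) * T) ^ 2 ≤ 1 / 2 →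
        ∀ Ω : Finset (Balaban1983to89.Site P 0), IsBlockUnion k Ω →
          ∀ (x : Balaban1983to89.Site P 0) (μ : Fin P.d) (f : Balaban1983to89.Site P 0 → ℂ) (F D : ℝ),
            (∀ z, ‖f z‖ ≤ F) → (∀ z, f z ≠ 0 → D ≤ (supDist x z : ℝ)) →
            (∀ w, w ∉ Ω → P.L ^ k ≤ supDist x w) →
            ‖covD P.eps⁻¹ (cfg U) (gBox (B1RG242Torus.α P a k * (P.L : ℝ) ^ (k * P.d)) P.eps⁻¹ U k Ω *ᵥ f) ⟨x, μ⟩‖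
              ≤ c₁ * P.spacing k * Real.exp (-(t₀ * D / (P.L : ℝ) ^ k)) * F := by
  obtain ⟨t₀, c₁, ht₀, hc₁, H⟩ := decay110_smallField_region_deriv d L hd1 hd3 hL ha
  refine ⟨t₀, c₁, ht₀, hc₁, ?_⟩
  intro P hPd hPL k hk1 hkK hR U θ hθ hplaq hsmall T hT hsmallT Ω hΩ x μ f F D hF hsupp hdeep
  have hk : k ≤ P.m + P.K := hkK.trans (Nat.le_add_left _ _)
  have hk0 : 0 + k ≤ P.m + P.K := by omega
  have hL1 : (1 : ℝ) < P.L := B1RG242Torus.one_lt_cast_L P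
  have ha' : 0 < B1RG242Torus.α P a k * (P.L : ℝ) ^ (k * P.d) :=
    mul_pos (mul_pos (B1.aSeq_pos ha hL1 hk1) (inv_pos.2 (pow_pos (P.spacing_pos k) 2))) (pow_pos P.cast_L_pos _)
  have hc' : P.eps⁻¹ ≠ 0 := inv_ne_zero P.eps_pos.ne'
  obtain ⟨hInt, hTree⟩ := smallField_blockGauge hk0 U hθ hplaq hR hT
  set h : GaugeTransf P 0 U1 := fun z => centredGauge U (cornerIter k (blkIter k z)) (P.L ^ k - 1) z with hh
  rw [← norm_covD_gBox_gaugeAct_mulVec hk0 hc' ha' h U hΩ f x μ]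
  exact H P hPd hPL k hk1 hkK Ω hΩ (GaugeField.gaugeAct h U) θ T (P.d * ((P.L : ℝ) ^ k - 1) * T) hθ
    (fun p => by rw [norm_toC_plaqHol_gaugeAct_sub_one]; exact hplaq p) hsmall (fun b _ hb => hInt b hb) (fun y _ => hTree y) hsmallT x μ _
    F D (fun z => by rw [norm_mul, norm_toC, one_mul]; exact hF z) (fun z hz => hsupp z (fun hf => hz (by rw [hf, mul_zero]))) hdeep

/-- **THE SAME IN THE (H1.10″)-type INPUT SHAPE** (distance `B5Ineq137Torus.T`, one power of the spacing, rate `e^{−t₀(L^k)^{−1}D}`, deep rows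
as the ball condition `T(x,y) < L^k → y ∈ Ω`), threshold depending on `(d, L^k)` only, every block union.
[cite: BalabanImbrieJaffe1985, (7.3.1)–(7.3.2) p.326; Balaban1983RegularityDecay, (1.10) p.573] -/
theorem decay110_smallPlaquette_region_deriv_uniform_input (d L : ℕ) (hd1 : 1 ≤ d) (hd3 : d + 1 ≤ 3) (hL : Odd L ∧ 1 < L) {a : ℝ}
    (ha : 0 < a) :
    ∃ t₀ c₁ : ℝ, 0 < t₀ ∧ 0 < c₁ ∧ ∀ (P : Params), P.d = d + 1 → P.L = L →
      ∀ k : ℕ, 1 ≤ k → k ≤ P.K → 2 * (P.L ^ k - 1) + 4 < P.sitesPerDir 0 →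
      ∀ (U : GaugeField P 0 U1) (θ : ℝ), 0 ≤ θ →
        (∀ p : Balaban1983to89.Plaq P 0, ‖toC (GaugeField.plaqHol U p) - 1‖ ≤ θ) →
        2 * (P.d : ℝ) ^ 3 * (((P.L : ℝ) ^ k) ^ 2 * θ) ^ 2 ≤ 1 →
        ∀ (T : ℝ), ((P.d - 1 : ℕ) : ℝ) * ((P.L : ℝ) ^ k - 1) * θ ≤ T →
          2 * (((P.L : ℝ) ^ k - 1) * (P.L : ℝ) ^ k) * P.d * T ^ 2 + 2 * (P.d * ((P.L : ℝ) ^ k - 1) * T) ^ 2 ≤ 1 / 2 →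
        ∀ Ω : Finset (Balaban1983to89.Site P 0), IsBlockUnion k Ω →
          ∀ (x : Balaban1983to89.Site P 0), (∀ y, B5Ineq137Torus.T P 0 x y < (P.L : ℝ) ^ k → y ∈ Ω) →
          ∀ (f : Balaban1983to89.Site P 0 → ℂ) (F D : ℝ), (∀ y, ‖f y‖ ≤ F) → (∀ y, f y ≠ 0 → D ≤ B5Ineq137Torus.T P 0 x y) →
          ∀ (μ : Fin P.d),
            ‖covD P.eps⁻¹ (cfg U) (gBox (B1RG242Torus.α P a k * (P.L : ℝ) ^ (k * P.d)) P.eps⁻¹ U k Ω *ᵥ f) ⟨x, μ⟩‖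
              ≤ P.spacing k * (c₁ * Real.exp (-(t₀ * (((P.L : ℝ) ^ k)⁻¹ * D))) * F) := by
  obtain ⟨t₀, c₁, ht₀, hc₁, H⟩ := decay110_smallPlaquette_region_deriv_uniform d L hd1 hd3 hL ha
  refine ⟨t₀, c₁, ht₀, hc₁, ?_⟩
  intro P hPd hPL k hk1 hkK hR U θ hθ hplaq hsmall T hT hsmallT Ω hΩ x hdeep f F D hF hsupp μ
  have h := H P hPd hPL k hk1 hkK hR U θ hθ hplaq hsmall T hT hsmallT Ω hΩ x μ f F D hF
    (fun z hz => by rw [← B3Bound323ZeroTorus.T_eq_supDist]; exact hsupp z hz)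
    (fun w hw => by
      by_contra hlt
      exact hw (hdeep w (by rw [B3Bound323ZeroTorus.T_eq_supDist]; exact_mod_cast (not_le.1 hlt))))
  calc _ ≤ c₁ * P.spacing k * Real.exp (-(t₀ * D / (P.L : ℝ) ^ k)) * F := h
    _ = P.spacing k * (c₁ * Real.exp (-(t₀ * (((P.L : ℝ) ^ k)⁻¹ * D))) * F) := by
        rw [show t₀ * D / (P.L : ℝ) ^ k = t₀ * (((P.L : ℝ) ^ k)⁻¹ * D) by ring]; ring

end Corollaries

end

end Literature.MathematicalPhysics.QuantumFieldTheory.BalabanImbrieJaffe1984to88.BIJ88NeumannPropagatorSmallFieldRegionDeriv
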